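import Summits.QuantumFields.BalabanUV.Beta.GAN24.DirichletVertexStarBox
import Summits.QuantumFields.BalabanUV.Beta.GAN24.DirichletVertexHessian
import Summits.QuantumFields.BalabanUV.Beta.GAN24.DirichletVertexEnergy

/-!
# `BalabanUV.Beta.GAN24.DirichletVertexLocalVertex` — binder row G-an2-4 / (CONV-C), road P2 PART IV, leaf L14 (the torus transfer), FILE U4a:
# THE PER-VERTEX WEIGHTED ENERGY AND DYADIC HESSIAN WITH WINDOW-LOCAL CURRENCIES (parametric form of p244737 / p244740)
# (unit b2b-balaban-gan24-p2, gen 27, v1)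

HONEST FRAMING (cell contract, verbatim): «discharging `BetaPertH` makes Bałaban's UV stability UNCONDITIONAL — a real constructive-QFT
result; it is NOT the continuum limit and NOT the Clay problem.»  SUPPLIER module under the T⁴-DAG sub-row `T4-U1a.S-NE2-D1-DIRICHLET°`.
`DirichletVertexEnergy.vertex_weighted_energy_le` (p244737) and `DirichletVertexHessian.vertex_weighted_hessian_le` (p244740) bound the
weighted energy / Hessian charged to ONE re-entrant vertex by the GLOBAL budgets `E = ‖∂₀u‖²+‖∂₁u‖²`, `B = Σ_Ω|Δu|²`, so that a family `V`
costs `|V|` (LOCATED L27-1 of memo `gen27/L14-END.md`).  Their proofs pass through the WINDOW-LOCAL currencies `Et (Uc u) (n−1)` (ring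
energy of the window) and `sqSum ‖Gc u‖² (n−1)` (window Laplacian); THIS FILE re-exports the two bounds with those currencies as parameters
(proofs verbatim from p244737/p244740); the next file `DirichletVertexLocalSums` bounds the currencies by star-box sums and sums the family.

## Contents ([folklore]; 0 sorry)
* `vertex_weighted_energy_le_of`, `vertex_weighted_hessian_le_of` (parametric currencies `E_v`, `B_v`).

ABSOLUTE RULE (cell, verbatim): «No internally-minted statement may enter as a cited fact. Every hypothesis is either kernel-proved in
this package or a verbatim quotation of a PUBLISHED theorem with page reference. The manuscript(s) under audit are NOT citable for
their own disputed steps — they are the thing under adjudication; programme-internal (2001/route/tribunal) claims are never citable.»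
Nothing printed is a hypothesis.  NOT CLAIMED: the volume-uniform END (next files); NOT NE2, (CONV-C), `BetaPertH`, continuum, Clay.
«not in print; our proof attempt».  HONEST DEPENDENCY: continuum YM on T⁴ ⇐ BetaPertH ∧ nine spine estimates (0/9 proved); BetaPertH ⇐
(D1) ∧ (D4) ∧ CAP+tail; G-an2-4 gates asym, D1 and NE2/3/4.
-/

noncomputable section

open scoped BigOperators ComplexConjugate Matrix
open Finset

namespace Summit.QuantumFields.BalabanUV.Beta.GAN24.DirichletVertexLocalVertex

open Literature.MathematicalPhysics.QuantumFieldTheory.Balaban1983to89.B5Prop11Plancherel (Tor fine unitVec)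
open Literature.MathematicalPhysics.QuantumFieldTheory.Balaban1983to89.B5Action121 (sdiff LapS)
open Literature.MathematicalPhysics.QuantumFieldTheory.Balaban1983to89.B5Prop11Lower (nsq nsq_nonneg)
open Summit.QuantumFields.BalabanUV.Beta.GAN24.DirichletBoxRegularity (Pdir)
open Summit.QuantumFields.BalabanUV.Beta.GAN24.DirichletBoxTrace (blockReg)
open DirichletRingEnergies (hb vb lap Et sqSum Et_nonneg sqSum_nonneg hb_nonneg vb_nonneg)
open DirichletRingHessianIdentity (d1 d2 offQ)
open DirichletRingHessianWindow (rho nbr)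
open DirichletRingLayerCake (wJ)
open DirichletRingSiteWeighted (site_weighted_energy_le)
open DirichletRingHessian (weighted_hessian_le)
open DirichletVertexChart
open DirichletVertexPullback
open DirichletVertexEnergy (invW omegaV inv_omegaV sum_invW_mul one_le_rho nbr_Up_eq bonds_eq_nbr)
open DirichletVertexHessian (hessW sum_hessW_mul offQ_hess_Up_eq)
open DirichletVertexStarBox (boxSum sum_sub_range_le window_le_boxSum sum_family_boxSum_le reentrant_injOn)

variable (n : ℕ) [NeZero n] (M : Fin 2 → ℕ) [hM : ∀ μ, NeZero (M μ)]

/-! ## §1 The per-vertex bounds with the window-local currencies as parameters -/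

section Vertex

variable {S : Tor M → Prop} {σ : Fin 2 → Bool} {b : Tor M} {u : Tor (fine n M) → ℂ}

/-- **THE WEIGHTED ENERGY CHARGED TO ONE RE-ENTRANT VERTEX, LOCAL CURRENCIES**: if `Et (Uc u) (n−1) ≤ E/n²` and
`sqSum ‖Gc u‖² (n−1) ≤ B/n⁴` then `Σ_μ Σ_y invW_{(σ,b)}(y)|(∂_μu)(y)|² ≤ 4(1+16/(γ−1))·E + (128π/((γ−1)ε(2−γ)))·B`
(the proof of p244737 `vertex_weighted_energy_le` with the two sum comparisons replaced by hypotheses). [folklore] -/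
theorem vertex_weighted_energy_le_of [DecidablePred S] (hu : ∀ x, ¬ blockReg n M S x → u x = 0) (hre : ReentrantAt M S σ b)
    (hn : 2 ≤ n) {ε : ℝ} (hε : 0 < ε) (hγ : 1 < Real.pi / 3 * (1 - ε / 2)) {E B : ℝ} (hE0 : 0 ≤ E) (hB0 : 0 ≤ B)
    (hEt : Et (Uc n M σ b u) (n - 1) ≤ E / (n : ℝ) ^ 2)
    (hSG : sqSum (fun i j => ‖Gc n M σ b u i j‖ ^ 2) (n - 1) ≤ B / (n : ℝ) ^ 4) :
    ∑ μ, ∑ y, invW n M (σ, b) (n - 1) y * ‖(sdiff (fine n M) (n : ℂ) μ *ᵥ u) y‖ ^ 2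
      ≤ 4 * (1 + 16 / (Real.pi / 3 * (1 - ε / 2) - 1)) * E
        + 128 * Real.pi / ((Real.pi / 3 * (1 - ε / 2) - 1) * ε * (2 - Real.pi / 3 * (1 - ε / 2))) * B := by
  set K : ℕ := n - 1 with hK
  have hK1 : 1 ≤ K := by omega
  set γ : ℝ := Real.pi / 3 * (1 - ε / 2) with hγdef
  set U : ℤ → ℤ → ℂ := Uc n M σ b u with hUdef
  have hπ3 := Real.pi_gt_three
  have hε2 : ε < 2 := by
    by_contra h
    have : Real.pi / 3 * (1 - ε / 2) ≤ 0 := mul_nonpos_of_nonneg_of_nonpos (by positivity) (by linarith)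
    linarith
  have hγ2 : γ < 2 := by
    have : Real.pi / 3 * (1 - ε / 2) < Real.pi / 3 * 1 := mul_lt_mul_of_pos_left (by linarith) (by positivity)
    rw [hγdef]; linarith [Real.pi_lt_four]
  have hγ1 : 0 < γ - 1 := by rw [hγdef]; linarith
  have h2γ : 0 < 2 - γ := by linarith
  have hnR : (2 : ℝ) ≤ n := by exact_mod_cast hn
  have hn0 : (0 : ℝ) < n := by linarith
  have hKR : (K : ℝ) = n - 1 := by rw [hK]; push_cast [Nat.cast_sub (by omega : 1 ≤ n)]; ring
  have hK0 : (0 : ℝ) < K := by rw [hKR]; linarith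
  have hUq : ∀ s t : ℤ, 0 ≤ s → 0 ≤ t → U s t = 0 := Uc_quadrant n M σ b u
  have hEq : ∀ i j : ℤ, -(K : ℤ) ≤ i → i < K → -(K : ℤ) ≤ j → j < K → ¬(0 ≤ i ∧ 0 ≤ j) → lap U i j = Gc n M σ b u i j :=
    fun i j hi hi' hj hj' hq => lap_Uc_eq_Gc n M hu hre i j (by omega) (by omega) (by omega) (by omega) hq
  have hsite := site_weighted_energy_le U hK1 (Gc n M σ b u) hUq hEq hε hγ
  have step1 : ∑ μ, ∑ y, invW n M (σ, b) K y * ‖(sdiff (fine n M) (n : ℂ) μ *ᵥ u) y‖ ^ 2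
      ≤ (n : ℝ) ^ 3 * sqSum (fun i j => nbr U i j / (rho i j : ℝ)) K := by
    rw [Fin.sum_univ_two, sum_invW_mul, sum_invW_mul, ← sum_add_distrib, sqSum, mul_sum]
    refine sum_le_sum fun t ht => ?_
    rw [← sum_add_distrib, mul_sum]
    refine sum_le_sum fun s hs => ?_
    simp only [mem_range] at ht hs
    set i : ℤ := -(K : ℤ) + s with hi
    set j : ℤ := -(K : ℤ) + t with hj
    have hρ : (0 : ℝ) < (rho i j : ℝ) := by exact_mod_cast (one_le_rho i j)
    have h0 := normSq_sdiff_emb_fst_le n M σ b u i j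
    have h1 := normSq_sdiff_emb_snd_le n M σ b u i j
    have hnbr : hb (Up n M σ b u) i j + hb (Up n M σ b u) (i - 1) j + (vb (Up n M σ b u) i j + vb (Up n M σ b u) i (j - 1))
        = nbr U i j := by
      rw [← add_assoc, bonds_eq_nbr, hUdef, nbr_Up_eq n M hu hre (by omega) (by omega)]
    calc (n : ℝ) / (rho i j : ℝ) * ‖(sdiff (fine n M) (n : ℂ) 0 *ᵥ u) (emb n M σ b i j)‖ ^ 2
          + (n : ℝ) / (rho i j : ℝ) * ‖(sdiff (fine n M) (n : ℂ) 1 *ᵥ u) (emb n M σ b i j)‖ ^ 2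
        ≤ (n : ℝ) / (rho i j : ℝ) * ((n : ℝ) ^ 2 * (hb (Up n M σ b u) i j + hb (Up n M σ b u) (i - 1) j))
          + (n : ℝ) / (rho i j : ℝ) * ((n : ℝ) ^ 2 * (vb (Up n M σ b u) i j + vb (Up n M σ b u) i (j - 1))) :=
          add_le_add (mul_le_mul_of_nonneg_left h0 (by positivity)) (mul_le_mul_of_nonneg_left h1 (by positivity))
      _ = (n : ℝ) ^ 3 * (nbr U i j / (rho i j : ℝ)) := by
          rw [← hnbr]; ring
  have hM : Et U K + (Real.pi / (2 * ε) * sqSum (fun i j => ‖Gc n M σ b u i j‖ ^ 2) K) * ((K : ℝ) + 3) ^ 2 / (2 - γ)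
      ≤ (E + 2 * Real.pi / (ε * (2 - γ)) * B) / (n : ℝ) ^ 2 := by
    have hK3 : ((K : ℝ) + 3) ^ 2 ≤ 4 * (n : ℝ) ^ 2 := by rw [hKR]; nlinarith
    have hSG0 : 0 ≤ sqSum (fun i j => ‖Gc n M σ b u i j‖ ^ 2) K := sqSum_nonneg _ (fun _ _ => sq_nonneg _) _
    calc Et U K + (Real.pi / (2 * ε) * sqSum (fun i j => ‖Gc n M σ b u i j‖ ^ 2) K) * ((K : ℝ) + 3) ^ 2 / (2 - γ)
        ≤ E / (n : ℝ) ^ 2 + (Real.pi / (2 * ε) * (B / (n : ℝ) ^ 4)) * (4 * (n : ℝ) ^ 2) / (2 - γ) := by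
          gcongr
      _ = (E + 2 * Real.pi / (ε * (2 - γ)) * B) / (n : ℝ) ^ 2 := by
          field_simp
          ring
  have step2 : sqSum (fun i j => nbr U i j / (rho i j : ℝ)) K
      ≤ 2 * ((E / (n : ℝ) ^ 2 + 16 / (γ - 1) * ((E + 2 * Real.pi / (ε * (2 - γ)) * B) / (n : ℝ) ^ 2)) / K) := by
    refine hsite.trans ?_
    gcongr
  have step3 : (n : ℝ) ^ 3 * (2 * ((E / (n : ℝ) ^ 2 + 16 / (γ - 1) * ((E + 2 * Real.pi / (ε * (2 - γ)) * B) / (n : ℝ) ^ 2)) / K))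
      ≤ 4 * (1 + 16 / (γ - 1)) * E + 128 * Real.pi / ((γ - 1) * ε * (2 - γ)) * B := by
    have hKinv : (n : ℝ) / K ≤ 2 := by rw [div_le_iff₀ hK0, hKR]; linarith
    have e1 : (n : ℝ) ^ 3 * (2 * ((E / (n : ℝ) ^ 2 + 16 / (γ - 1) * ((E + 2 * Real.pi / (ε * (2 - γ)) * B) / (n : ℝ) ^ 2)) / K))
        = ((n : ℝ) / K) * (2 * ((1 + 16 / (γ - 1)) * E + 32 * Real.pi / ((γ - 1) * ε * (2 - γ)) * B)) := by
      field_simp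
      ring
    rw [e1]
    have hX : 0 ≤ 2 * ((1 + 16 / (γ - 1)) * E + 32 * Real.pi / ((γ - 1) * ε * (2 - γ)) * B) := by positivity
    calc (n : ℝ) / K * (2 * ((1 + 16 / (γ - 1)) * E + 32 * Real.pi / ((γ - 1) * ε * (2 - γ)) * B))
        ≤ 2 * (2 * ((1 + 16 / (γ - 1)) * E + 32 * Real.pi / ((γ - 1) * ε * (2 - γ)) * B)) :=
          mul_le_mul_of_nonneg_right hKinv hX
      _ = 4 * (1 + 16 / (γ - 1)) * E + 128 * Real.pi / ((γ - 1) * ε * (2 - γ)) * B := by ring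
  calc _ ≤ (n : ℝ) ^ 3 * sqSum (fun i j => nbr U i j / (rho i j : ℝ)) K := step1
    _ ≤ (n : ℝ) ^ 3 * (2 * ((E / (n : ℝ) ^ 2 + 16 / (γ - 1) * ((E + 2 * Real.pi / (ε * (2 - γ)) * B) / (n : ℝ) ^ 2)) / K)) :=
        mul_le_mul_of_nonneg_left step2 (by positivity)
    _ ≤ _ := step3

/-- **THE WEIGHTED HESSIAN CHARGED TO ONE RE-ENTRANT VERTEX, LOCAL CURRENCIES**: under the same two hypotheses and `20·2^J + 1 ≤ n − 1`,
`Σ_μ Σ_x hessW_{(σ,b)}(x)|(∂ᴴ_μ∂_μu)(x)|² ≤ 2(112+10⁹/(γ−1))·E + (8/5 + 4π(112+10⁹/(γ−1))/(ε(2−γ)))·B` (proof of p244740 verbatim). [folklore] -/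
theorem vertex_weighted_hessian_le_of [DecidablePred S] (hu : ∀ x, ¬ blockReg n M S x → u x = 0) (hre : ReentrantAt M S σ b)
    (hn : 2 ≤ n) {J : ℕ} (hJ : 20 * 2 ^ J + 1 ≤ n - 1) {ε : ℝ} (hε : 0 < ε) (hγ : 1 < Real.pi / 3 * (1 - ε / 2))
    {E B : ℝ} (hE0 : 0 ≤ E) (hB0 : 0 ≤ B)
    (hEt : Et (Uc n M σ b u) (n - 1) ≤ E / (n : ℝ) ^ 2)
    (hSG : sqSum (fun i j => ‖Gc n M σ b u i j‖ ^ 2) (n - 1) ≤ B / (n : ℝ) ^ 4) :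
    ∑ μ, ∑ x, hessW n M (σ, b) (n - 1) J x * ‖(Pdir (fine n M) (n : ℂ) μ *ᵥ u) x‖ ^ 2
      ≤ 2 * (112 + 10 ^ 9 / (Real.pi / 3 * (1 - ε / 2) - 1)) * E
        + (8 / 5 + 4 * Real.pi * (112 + 10 ^ 9 / (Real.pi / 3 * (1 - ε / 2) - 1)) / (ε * (2 - Real.pi / 3 * (1 - ε / 2)))) * B := by
  set K : ℕ := n - 1 with hK
  have hK1 : 1 ≤ K := by omega
  set γ : ℝ := Real.pi / 3 * (1 - ε / 2) with hγdef
  set U : ℤ → ℤ → ℂ := Uc n M σ b u with hUdef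
  set C : ℝ := 112 + 10 ^ 9 / (γ - 1) with hC
  have hπ3 := Real.pi_gt_three
  have hε2 : ε < 2 := by
    by_contra h
    have : Real.pi / 3 * (1 - ε / 2) ≤ 0 := mul_nonpos_of_nonneg_of_nonpos (by positivity) (by linarith)
    linarith
  have hγ2 : γ < 2 := by
    have : Real.pi / 3 * (1 - ε / 2) < Real.pi / 3 * 1 := mul_lt_mul_of_pos_left (by linarith) (by positivity)
    rw [hγdef]; linarith [Real.pi_lt_four]
  have hγ1 : 0 < γ - 1 := by rw [hγdef]; linarith
  have h2γ : 0 < 2 - γ := by linarith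
  have hnR : (2 : ℝ) ≤ n := by exact_mod_cast hn
  have hn0 : (0 : ℝ) < n := by linarith
  have hKR : (K : ℝ) = n - 1 := by rw [hK]; push_cast [Nat.cast_sub (by omega : 1 ≤ n)]; ring
  have hK0 : (0 : ℝ) < K := by rw [hKR]; linarith
  have hC0 : 0 < C := by positivity
  have hUq : ∀ s t : ℤ, 0 ≤ s → 0 ≤ t → U s t = 0 := Uc_quadrant n M σ b u
  have hEq : ∀ i j : ℤ, -(K : ℤ) ≤ i → i < K → -(K : ℤ) ≤ j → j < K → ¬(0 ≤ i ∧ 0 ≤ j) → lap U i j = Gc n M σ b u i j :=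
    fun i j hi hi' hj hj' hq => lap_Uc_eq_Gc n M hu hre i j (by omega) (by omega) (by omega) (by omega) hq
  have hmodel := weighted_hessian_le U hJ (Gc n M σ b u) hUq hEq hε hγ
  have step1 : ∑ μ, ∑ x, hessW n M (σ, b) K J x * ‖(Pdir (fine n M) (n : ℂ) μ *ᵥ u) x‖ ^ 2
      = (n : ℝ) ^ 3 * sqSum (fun i j => offQ i j * wJ J i j * (‖d1 U i j‖ ^ 2 + ‖d2 U i j‖ ^ 2)) K := by
    rw [Fin.sum_univ_two, sum_hessW_mul, sum_hessW_mul, ← sum_add_distrib, sqSum, mul_sum]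
    refine sum_congr rfl fun t ht => ?_
    rw [← sum_add_distrib, mul_sum]
    refine sum_congr rfl fun s hs => ?_
    simp only [mem_range] at ht hs
    set i : ℤ := -(K : ℤ) + s with hi
    set j : ℤ := -(K : ℤ) + t with hj
    have hw := offQ_hess_Up_eq n M hu hre (i := i) (j := j) (by omega) (by omega) (by omega) (by omega)
    rw [Pdir_emb_fst, Pdir_emb_snd, norm_mul, norm_mul, norm_neg, norm_pow, Complex.norm_natCast, mul_pow, mul_pow, ← pow_mul,
      ← mul_add, ← mul_add, show 2 * 2 = 4 by rfl, hUdef]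
    have e : offQ i j * wJ J i j / (n : ℝ) * ((n : ℝ) ^ 4 * (‖d1 (Up n M σ b u) i j‖ ^ 2 + ‖d2 (Up n M σ b u) i j‖ ^ 2))
        = (n : ℝ) ^ 3 * (wJ J i j * (offQ i j * (‖d1 (Up n M σ b u) i j‖ ^ 2 + ‖d2 (Up n M σ b u) i j‖ ^ 2))) := by
      field_simp
    rw [e, hw]
    ring
  have hM : Et U K + (Real.pi / (2 * ε) * sqSum (fun i j => ‖Gc n M σ b u i j‖ ^ 2) K) * ((K : ℝ) + 3) ^ 2 / (2 - γ)
      ≤ (E + 2 * Real.pi / (ε * (2 - γ)) * B) / (n : ℝ) ^ 2 := by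
    have hK3 : ((K : ℝ) + 3) ^ 2 ≤ 4 * (n : ℝ) ^ 2 := by rw [hKR]; nlinarith
    have hSG0 : 0 ≤ sqSum (fun i j => ‖Gc n M σ b u i j‖ ^ 2) K := sqSum_nonneg _ (fun _ _ => sq_nonneg _) _
    calc Et U K + (Real.pi / (2 * ε) * sqSum (fun i j => ‖Gc n M σ b u i j‖ ^ 2) K) * ((K : ℝ) + 3) ^ 2 / (2 - γ)
        ≤ E / (n : ℝ) ^ 2 + (Real.pi / (2 * ε) * (B / (n : ℝ) ^ 4)) * (4 * (n : ℝ) ^ 2) / (2 - γ) := by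
          gcongr
      _ = (E + 2 * Real.pi / (ε * (2 - γ)) * B) / (n : ℝ) ^ 2 := by
          field_simp
          ring
  have step2 : sqSum (fun i j => offQ i j * wJ J i j * (‖d1 U i j‖ ^ 2 + ‖d2 U i j‖ ^ 2)) K
      ≤ 8 / 5 * K * (B / (n : ℝ) ^ 4) + C * ((E + 2 * Real.pi / (ε * (2 - γ)) * B) / (n : ℝ) ^ 2) / K := by
    refine hmodel.trans ?_
    rw [hC]
    gcongr
  have step3 : (n : ℝ) ^ 3 * (8 / 5 * K * (B / (n : ℝ) ^ 4) + C * ((E + 2 * Real.pi / (ε * (2 - γ)) * B) / (n : ℝ) ^ 2) / K)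
      ≤ 2 * C * E + (8 / 5 + 4 * Real.pi * C / (ε * (2 - γ))) * B := by
    have hKn' : (K : ℝ) / n ≤ 1 := by rw [div_le_one hn0, hKR]; linarith
    have hnK : (n : ℝ) / K ≤ 2 := by rw [div_le_iff₀ hK0, hKR]; linarith
    have e1 : (n : ℝ) ^ 3 * (8 / 5 * K * (B / (n : ℝ) ^ 4) + C * ((E + 2 * Real.pi / (ε * (2 - γ)) * B) / (n : ℝ) ^ 2) / K)
        = ((K : ℝ) / n) * (8 / 5 * B) + ((n : ℝ) / K) * (C * (E + 2 * Real.pi / (ε * (2 - γ)) * B)) := by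
      field_simp
    rw [e1]
    have hX : 0 ≤ 8 / 5 * B := by positivity
    have hY : 0 ≤ C * (E + 2 * Real.pi / (ε * (2 - γ)) * B) := by positivity
    calc (K : ℝ) / n * (8 / 5 * B) + (n : ℝ) / K * (C * (E + 2 * Real.pi / (ε * (2 - γ)) * B))
        ≤ 1 * (8 / 5 * B) + 2 * (C * (E + 2 * Real.pi / (ε * (2 - γ)) * B)) :=
          add_le_add (mul_le_mul_of_nonneg_right hKn' hX) (mul_le_mul_of_nonneg_right hnK hY)
      _ = 2 * C * E + (8 / 5 + 4 * Real.pi * C / (ε * (2 - γ))) * B := by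
          field_simp
          ring
  calc _ = (n : ℝ) ^ 3 * sqSum (fun i j => offQ i j * wJ J i j * (‖d1 U i j‖ ^ 2 + ‖d2 U i j‖ ^ 2)) K := step1
    _ ≤ (n : ℝ) ^ 3 * (8 / 5 * K * (B / (n : ℝ) ^ 4) + C * ((E + 2 * Real.pi / (ε * (2 - γ)) * B) / (n : ℝ) ^ 2) / K) :=
        mul_le_mul_of_nonneg_left step2 (by positivity)
    _ ≤ _ := step3

end Vertex

end Summit.QuantumFields.BalabanUV.Beta.GAN24.DirichletVertexLocalVertex

end
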